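import Summits.QuantumFields.BalabanUV.Beta.D1BFx.ProfileWordCount

/-!
# `BalabanUV.Beta.D1BFx.OrientedProfileWords` — road «BF-x» for binder row D1, slot (K), GHOST-N8-SPEC v0.2 §3″ FILE F2 «ORIENTED PROFILE WORDS»:
# **THE TWO-LEG WORD FROM TWO-TERM ORIENTED MAJORANTS IS FOUR SUB-CRITICAL DAMPED DOUBLE RIESZ COUNTS**, its (5.10) family form with an n-FREE
# coarse rate, and **THE TADPOLE OVER A FINITE-RANGE TWO-CENTRE TABLE IS `sup × centre count`** (generic dimension `D`, fibre `F`)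

HONEST DEPENDENCY (cell records, verbatim): «continuum YM on T⁴ ⇐ BetaPertH ∧ nine spine estimates (0/9 proved); BetaPertH ⇐ (D1) ∧ (D4) ∧
CAP+tail; G-an2-4 gates asym, D1 and NE2/3/4.»  HONEST FRAMING (cell contract, verbatim): «discharging `BetaPertH` makes Bałaban's UV stability
UNCONDITIONAL — a real constructive-QFT result; it is NOT the continuum limit and NOT the Clay problem.»  THIS MODULE DISCHARGES NOTHING of the
wall: [folklore] lattice bookkeeping over this lineage's `ProfileWordCount` (PART 1: `sum_sum_damped_riesz_le`, `abs_tr_comp_le_of_majorant`,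
`exp_centres_le`) and the g9 kit `LatticeHLSRadial.sum_pow_mul_exp_scale_le`; the kernels `A`, `B`, `L`, `W` are ARBITRARY and every letter about
them is a DISPLAYED hypothesis.  No definition, no `def … : Prop`, nothing cited, 0 sorry.  0 root-level binders of row D1 discharged (hW ∕
hR-sockets ∕ hSX-socket ∕ D1Tel ∕ D1Rep = 0); (K) NOT closed; NOT D1, NOT `BetaPertH`, NOT continuum, NOT Clay.

ABSOLUTE RULE (cell charter, verbatim): «No internally-minted statement may enter as a cited fact. Every hypothesis is either kernel-proved in
this package or a verbatim quotation of a PUBLISHED theorem with page reference. The manuscript(s) under audit are NOT citable for their own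
disputed steps — they are the thing under adjudication; programme-internal (2001/route/tribunal) claims are never citable.»

WHY (GHOST-N8-SPEC v0.2 §3″ (O4); journal N-1 [D1LEAF04-G26-N1], INTENT-2).  A ghost rest word is `biBubble L₁ V L₂ V′ = tr (comp (comp L₁ V) (comp L₂ V′))`;
FILE F1 (`GhostVertexOrientation.abs_comp_gW_le`) prices each factor `comp Lᵢ V` by a TWO-TERM majorant
`(K∕nrm(x−z)^{p} + K′∕nrm(x−z)^{p′})·e^{−(δ∕n)‖x−z‖∞}·e^{−(σ∕n)‖z−centre‖∞}` — one term for the leg's right-end DIFFERENCE weighted by the column,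
one for the leg UNDIFFERENCED weighted by the column's difference, with DIFFERENT Riesz exponents.  (d1-a) (`ProfileWordFamilies`) takes one
profile per leg; this file is its oriented twin: the product of two two-term majorants is FOUR damped double Riesz sums, each sub-critical when its
own exponent sum is `≤ D − 1` (§1–§2), so no exponent is ever weakened to a common one (which would lose a power of `n`).  §3 reads the family form
as (5.10) decay in the coarse displacement with the n-FREE rate `min σ 2δ ∕ (2D)`; §4 prices a tadpole whose table has finite range `r` and a
two-centre density (the ghost pair table `n²•tableRedF (diag gh₂)` has `r = 1`, density `≍ n⁻⁸`) by `sup(leg) × (2r+1)^D × centre count` — the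
letter (d1-c) `abs_tadpole_le_of_profile` would spend `n^D` too many there; §5 packages n-powers for the rows file (F5).

CONTENT ([folklore]; `D ≥ 1`, fibre `F`; `n ≥ 1`).
* §1 `twoTerm_mul_le` — the pointwise product of the two majorants at the common rate `ε = min σ (2δ)`.
* §2 **`abs_tr_comp_le_of_twoTerm`** — `|tr (comp A B)| ≤ |F|²·(Σ_{i∈{1,2}, j∈{3,4}} Kᵢ·Kⱼ·K_{D,pᵢ+pⱼ}(ε)·n^{2D−(pᵢ+pⱼ)})·K′_D(ε)·e^{−(ε∕2n)‖C−C′‖∞}`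
  under `pᵢ + pⱼ ≤ D − 1` (all four), `K_{D,p}(ε)`, `K′_D(ε)` = PART 1 §2's two displayed constants.
* §3 **`decay510_biBubble_of_twoTerm`** — families `𝒱 μ y`, `𝒱′ ν y` whose compositions `comp L₁ (𝒱 μ y)`, `comp L₂ (𝒱′ ν y)` carry two-term majorants
  centred at `n•y` ⟹ `Decay510 (z ↦ biBubble L₁ (𝒱 μ 0) L₂ (𝒱′ ν z)) (|F|²·(…)) (ε∕(2D))`.
* §4 **`abs_tadpole_le_of_sup_range`**, **`decay510_tadpole_of_sup_range`** — `|L x y| ≤ S`, `|W y x| ≤ A₂·e^{−(σ∕n)‖x−C‖∞}·e^{−(σ∕n)‖x−C′‖∞}`, `W y x = 0`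
  unless `‖y−x‖∞ ≤ r` ⟹ `|tadpole L W| ≤ |F|²·S·(2r+1)^D·A₂·K″_D(σ)·n^D·e^{−(σ∕2n)‖C−C′‖∞}`.
* §5 `pow_bookkeeping` — `K ≤ c∕n^e`, `K′ ≤ c′∕n^{e′}`, `2D − p + t ≤ e + e′` ⟹ `K·K′·n^{2D−p} ≤ c·c′·n^{−t}` (`n ≥ 1`), the shape F5 applies ×4 per word.
NOT HERE (honest): the majorants themselves (F1 + the leg ∕ weight letters F3 ∕ F4), the rows (F5); anything of the END.
Unit `b2b-balaban-beta-d1-formalise-leaf-04` (gen 26), D1 formalisation swarm, road «BF-x»; INTENT-2 [D1LEAF04-G26-INTENT-2]. Not in print; no existing file touched.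
-/

noncomputable section

namespace Summit.QuantumFields.BalabanUV.Beta.D1BFx.OrientedProfileWords

open Finset Real
open scoped BigOperators
open Literature.MathematicalPhysics.QuantumFieldTheory.Balaban1983to89
open Literature.MathematicalPhysics.QuantumFieldTheory.Balaban1983to89.Beta
open B12Sec2to5 (l1 l1_nonneg Decay510)
open ExpKernelCalculus (Site MKer comp tr tadpole)
open PoissonInterior (cube mem_cube supNorm nrm supNorm_le_iff supNorm_add_le supNorm_neg nrm_pos one_le_nrm supNorm_le_nrm mem_cube_iff_supNorm)
open Summit.QuantumFields.BalabanUV.Beta.D1BFx.PackedKernelSplit (biBubble)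
open Summit.QuantumFields.BalabanUV.Beta.D1BFx.LatticeHLSRadial (sum_pow_mul_exp_scale_le)
open Summit.QuantumFields.BalabanUV.Beta.D1BFx.ProfileWordCount (sum_sum_damped_riesz_le abs_tr_comp_le_of_majorant exp_centres_le exp_three_le_half
  card_cube)

variable {D : ℕ} {F : Type*} [Fintype F]

/-! ## §1 The pointwise product of two two-term majorants at the common rate -/

omit [Fintype F] in
/-- [folklore] Two leg dampings and two centre dampings dominate the common-rate triple: with `ε = min σ (2δ)`, `1 ≤ n`,
`e^{−(δ∕n)s}·e^{−(σ∕n)t}·(e^{−(δ∕n)s}·e^{−(σ∕n)t′}) ≤ e^{−(ε∕n)s}·e^{−(ε∕n)t}·e^{−(ε∕n)t′}` for `s, t, t′ ≥ 0` (any real `δ, σ`). -/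
theorem exp_common_rate (δ σ : ℝ) {n : ℕ} (hn : 1 ≤ n) {s t t' : ℝ} (hs : 0 ≤ s) (ht : 0 ≤ t) (ht' : 0 ≤ t') :
    Real.exp (-(δ / n) * s) * Real.exp (-(σ / n) * t) * (Real.exp (-(δ / n) * s) * Real.exp (-(σ / n) * t'))
      ≤ Real.exp (-(min σ (2 * δ) / n) * s) * Real.exp (-(min σ (2 * δ) / n) * t) * Real.exp (-(min σ (2 * δ) / n) * t') := by
  have hn0 : (0 : ℝ) < n := by exact_mod_cast hn
  have hεσ : min σ (2 * δ) ≤ σ := min_le_left _ _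
  have hεδ : min σ (2 * δ) ≤ 2 * δ := min_le_right _ _
  rw [← Real.exp_add, ← Real.exp_add, ← Real.exp_add, ← Real.exp_add, ← Real.exp_add]
  apply Real.exp_le_exp.mpr
  have h1 : min σ (2 * δ) / n * s ≤ 2 * δ / n * s := mul_le_mul_of_nonneg_right (div_le_div_of_nonneg_right hεδ hn0.le) hs
  have h2 : min σ (2 * δ) / n * t ≤ σ / n * t := mul_le_mul_of_nonneg_right (div_le_div_of_nonneg_right hεσ hn0.le) ht
  have h3 : min σ (2 * δ) / n * t' ≤ σ / n * t' := mul_le_mul_of_nonneg_right (div_le_div_of_nonneg_right hεσ hn0.le) ht'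
  have e : 2 * δ / (n : ℝ) * s = δ / n * s + δ / n * s := by ring
  linarith

omit [Fintype F] in
/-- [folklore] **THE PRODUCT OF TWO TWO-TERM MAJORANTS** (first at `(x,z)` centred at `C` on `z`, second at `(z,x)` centred at `C′` on `x`) is bounded by the
sum of FOUR single-exponent terms `KᵢKⱼ∕nrm(x−z)^{pᵢ+pⱼ}` times the common-rate triple damping (`ε = min σ (2δ)`). -/
theorem twoTerm_mul_le (δ σ : ℝ) {n : ℕ} (hn : 1 ≤ n) {K₁ K₂ K₃ K₄ : ℝ}
    (hK₁ : 0 ≤ K₁) (hK₂ : 0 ≤ K₂) (hK₃ : 0 ≤ K₃) (hK₄ : 0 ≤ K₄) (p₁ p₂ p₃ p₄ : ℕ) (x z C C' : Site D) :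
    (K₁ / nrm (x - z) ^ p₁ + K₂ / nrm (x - z) ^ p₂) * Real.exp (-(δ / n) * supNorm (x - z)) * Real.exp (-(σ / n) * supNorm (z - C))
        * ((K₃ / nrm (z - x) ^ p₃ + K₄ / nrm (z - x) ^ p₄) * Real.exp (-(δ / n) * supNorm (z - x)) * Real.exp (-(σ / n) * supNorm (x - C')))
      ≤ (K₁ * K₃ * (1 / nrm (x - z) ^ (p₁ + p₃)) + K₁ * K₄ * (1 / nrm (x - z) ^ (p₁ + p₄))
          + K₂ * K₃ * (1 / nrm (x - z) ^ (p₂ + p₃)) + K₂ * K₄ * (1 / nrm (x - z) ^ (p₂ + p₄)))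
        * (Real.exp (-(min σ (2 * δ) / n) * supNorm (x - z)) * Real.exp (-(min σ (2 * δ) / n) * supNorm (z - C))
          * Real.exp (-(min σ (2 * δ) / n) * supNorm (x - C'))) := by
  have hzx : nrm (z - x) = nrm (x - z) := by rw [show z - x = -(x - z) by abel, PoissonInterior.nrm_neg]
  have hzx' : supNorm (z - x) = supNorm (x - z) := by rw [show z - x = -(x - z) by abel, supNorm_neg]
  rw [hzx, hzx']
  have hq := nrm_pos (x - z)
  have t0 : (0 : ℝ) ≤ supNorm (x - z) := Nat.cast_nonneg _
  have t1 : (0 : ℝ) ≤ supNorm (z - C) := Nat.cast_nonneg _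
  have t2 : (0 : ℝ) ≤ supNorm (x - C') := Nat.cast_nonneg _
  have hexp := exp_common_rate δ σ hn t0 t1 t2
  have hP : 0 ≤ K₁ / nrm (x - z) ^ p₁ + K₂ / nrm (x - z) ^ p₂ := by positivity
  have hQ : 0 ≤ K₃ / nrm (x - z) ^ p₃ + K₄ / nrm (x - z) ^ p₄ := by positivity
  have epow : ∀ p q : ℕ, 1 / nrm (x - z) ^ (p + q) = (1 / nrm (x - z) ^ p) * (1 / nrm (x - z) ^ q) := fun p q => by
    rw [pow_add]; field_simp
  have eprod : (K₁ / nrm (x - z) ^ p₁ + K₂ / nrm (x - z) ^ p₂) * (K₃ / nrm (x - z) ^ p₃ + K₄ / nrm (x - z) ^ p₄)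
      = K₁ * K₃ * (1 / nrm (x - z) ^ (p₁ + p₃)) + K₁ * K₄ * (1 / nrm (x - z) ^ (p₁ + p₄))
          + K₂ * K₃ * (1 / nrm (x - z) ^ (p₂ + p₃)) + K₂ * K₄ * (1 / nrm (x - z) ^ (p₂ + p₄)) := by
    rw [epow, epow, epow, epow]; field_simp; ring
  calc (K₁ / nrm (x - z) ^ p₁ + K₂ / nrm (x - z) ^ p₂) * Real.exp (-(δ / n) * supNorm (x - z)) * Real.exp (-(σ / n) * supNorm (z - C))
        * ((K₃ / nrm (x - z) ^ p₃ + K₄ / nrm (x - z) ^ p₄) * Real.exp (-(δ / n) * supNorm (x - z)) * Real.exp (-(σ / n) * supNorm (x - C')))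
      = ((K₁ / nrm (x - z) ^ p₁ + K₂ / nrm (x - z) ^ p₂) * (K₃ / nrm (x - z) ^ p₃ + K₄ / nrm (x - z) ^ p₄))
        * (Real.exp (-(δ / n) * supNorm (x - z)) * Real.exp (-(σ / n) * supNorm (z - C))
          * (Real.exp (-(δ / n) * supNorm (x - z)) * Real.exp (-(σ / n) * supNorm (x - C')))) := by ring
    _ ≤ ((K₁ / nrm (x - z) ^ p₁ + K₂ / nrm (x - z) ^ p₂) * (K₃ / nrm (x - z) ^ p₃ + K₄ / nrm (x - z) ^ p₄))
        * (Real.exp (-(min σ (2 * δ) / n) * supNorm (x - z)) * Real.exp (-(min σ (2 * δ) / n) * supNorm (z - C))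
          * Real.exp (-(min σ (2 * δ) / n) * supNorm (x - C'))) := mul_le_mul_of_nonneg_left hexp (mul_nonneg hP hQ)
    _ = _ := by rw [eprod]

/-! ## §2 The trace of a product under two two-term majorants -/

/-- [folklore] **THE ORIENTED WORD LETTER (trace form).**  If `|A x z| ≤ (K₁∕nrm(x−z)^{p₁} + K₂∕nrm(x−z)^{p₂})·e^{−(δ∕n)‖x−z‖∞}·e^{−(σ∕n)‖z−C‖∞}` and
`|B z x| ≤ (K₃∕nrm(z−x)^{p₃} + K₄∕nrm(z−x)^{p₄})·e^{−(δ∕n)‖z−x‖∞}·e^{−(σ∕n)‖x−C′‖∞}` with ALL FOUR exponent sums `pᵢ + pⱼ ≤ D − 1`, then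
`|tr (comp A B)| ≤ |F|²·(K₁K₃·c(p₁+p₃)·n^{2D−(p₁+p₃)} + K₁K₄·c(p₁+p₄)·n^{2D−(p₁+p₄)} + K₂K₃·c(p₂+p₃)·n^{2D−(p₂+p₃)} + K₂K₄·c(p₂+p₄)·n^{2D−(p₂+p₄)})·c′·e^{−(ε∕2n)‖C−C′‖∞}`,
`ε = min σ (2δ)`, `c(p) = 2·(1 + 2D·3^{D−1}·((D−1−p)!·(8∕ε)^{D−1−p}·(1+8∕ε)))`, `c′ = 1 + 2D·3^{D−1}·((D−1)!·(4∕ε)^{D−1}·(1+4∕ε))` (PART 1 §2 ×4). -/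
theorem abs_tr_comp_le_of_twoTerm (hD : 0 < D) {n : ℕ} (hn : 1 ≤ n) {A B : MKer D F} {K₁ K₂ K₃ K₄ δ σ : ℝ} {p₁ p₂ p₃ p₄ : ℕ} {C C' : Site D}
    (hK₁ : 0 ≤ K₁) (hK₂ : 0 ≤ K₂) (hK₃ : 0 ≤ K₃) (hK₄ : 0 ≤ K₄) (hδ : 0 < δ) (hσ : 0 < σ)
    (h13 : p₁ + p₃ ≤ D - 1) (h14 : p₁ + p₄ ≤ D - 1) (h23 : p₂ + p₃ ≤ D - 1) (h24 : p₂ + p₄ ≤ D - 1)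
    (hA : ∀ x z g f, |A x z g f| ≤ (K₁ / nrm (x - z) ^ p₁ + K₂ / nrm (x - z) ^ p₂)
        * Real.exp (-(δ / n) * supNorm (x - z)) * Real.exp (-(σ / n) * supNorm (z - C)))
    (hB : ∀ z x f g, |B z x f g| ≤ (K₃ / nrm (z - x) ^ p₃ + K₄ / nrm (z - x) ^ p₄)
        * Real.exp (-(δ / n) * supNorm (z - x)) * Real.exp (-(σ / n) * supNorm (x - C'))) :
    |tr (comp A B)| ≤ (Fintype.card F : ℝ) ^ 2 *
      ((K₁ * K₃ * (2 * (1 + 2 * D * 3 ^ (D - 1) * ((D - 1 - (p₁ + p₃)).factorial * (8 / min σ (2 * δ)) ^ (D - 1 - (p₁ + p₃)) * (1 + 8 / min σ (2 * δ)))))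
            * (n : ℝ) ^ (2 * D - (p₁ + p₃))
        + K₁ * K₄ * (2 * (1 + 2 * D * 3 ^ (D - 1) * ((D - 1 - (p₁ + p₄)).factorial * (8 / min σ (2 * δ)) ^ (D - 1 - (p₁ + p₄)) * (1 + 8 / min σ (2 * δ)))))
            * (n : ℝ) ^ (2 * D - (p₁ + p₄))
        + K₂ * K₃ * (2 * (1 + 2 * D * 3 ^ (D - 1) * ((D - 1 - (p₂ + p₃)).factorial * (8 / min σ (2 * δ)) ^ (D - 1 - (p₂ + p₃)) * (1 + 8 / min σ (2 * δ)))))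
            * (n : ℝ) ^ (2 * D - (p₂ + p₃))
        + K₂ * K₄ * (2 * (1 + 2 * D * 3 ^ (D - 1) * ((D - 1 - (p₂ + p₄)).factorial * (8 / min σ (2 * δ)) ^ (D - 1 - (p₂ + p₄)) * (1 + 8 / min σ (2 * δ)))))
            * (n : ℝ) ^ (2 * D - (p₂ + p₄)))
        * (1 + 2 * D * 3 ^ (D - 1) * ((D - 1).factorial * (4 / min σ (2 * δ)) ^ (D - 1) * (1 + 4 / min σ (2 * δ))))
        * Real.exp (-(min σ (2 * δ) / 2 / n) * supNorm (C - C'))) := by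
  have hn0 : (0 : ℝ) < n := by exact_mod_cast hn
  set ε : ℝ := min σ (2 * δ) with hε
  have hε0 : 0 < ε := lt_min hσ (by linarith)
  -- the four PART 1 counts, abbreviated
  set c13 : ℝ := 2 * (1 + 2 * D * 3 ^ (D - 1) * ((D - 1 - (p₁ + p₃)).factorial * (8 / ε) ^ (D - 1 - (p₁ + p₃)) * (1 + 8 / ε))) with hc13
  set c14 : ℝ := 2 * (1 + 2 * D * 3 ^ (D - 1) * ((D - 1 - (p₁ + p₄)).factorial * (8 / ε) ^ (D - 1 - (p₁ + p₄)) * (1 + 8 / ε))) with hc14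
  set c23 : ℝ := 2 * (1 + 2 * D * 3 ^ (D - 1) * ((D - 1 - (p₂ + p₃)).factorial * (8 / ε) ^ (D - 1 - (p₂ + p₃)) * (1 + 8 / ε))) with hc23
  set c24 : ℝ := 2 * (1 + 2 * D * 3 ^ (D - 1) * ((D - 1 - (p₂ + p₄)).factorial * (8 / ε) ^ (D - 1 - (p₂ + p₄)) * (1 + 8 / ε))) with hc24
  set c' : ℝ := 1 + 2 * D * 3 ^ (D - 1) * ((D - 1).factorial * (4 / ε) ^ (D - 1) * (1 + 4 / ε)) with hc'
  set E : ℝ := Real.exp (-(ε / 2 / n) * supNorm (C - C')) with hE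
  -- the triple damping at rate `ε`
  let T : ℕ → Site D → Site D → ℝ := fun p x z =>
    1 / nrm (x - z) ^ p * Real.exp (-(ε / n) * supNorm (x - z)) * Real.exp (-(ε / n) * supNorm (z - C)) * Real.exp (-(ε / n) * supNorm (x - C'))
  have hT : ∀ {p : ℕ}, p ≤ D - 1 → ∀ S U : Finset (Site D), ∑ x ∈ S, ∑ z ∈ U, T p x z
      ≤ (2 * (1 + 2 * D * 3 ^ (D - 1) * ((D - 1 - p).factorial * (8 / ε) ^ (D - 1 - p) * (1 + 8 / ε)))) * c' * (n : ℝ) ^ (2 * D - p) * E := by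
    intro p hp S U
    have h := sum_sum_damped_riesz_le hD hε0 hn hp S U C C'
    simpa only [hc', hE] using h
  refine le_trans (abs_tr_comp_le_of_majorant
    (M₁ := fun x z => (K₁ / nrm (x - z) ^ p₁ + K₂ / nrm (x - z) ^ p₂) * Real.exp (-(δ / n) * supNorm (x - z)) * Real.exp (-(σ / n) * supNorm (z - C)))
    (M₂ := fun z x => (K₃ / nrm (z - x) ^ p₃ + K₄ / nrm (z - x) ^ p₄) * Real.exp (-(δ / n) * supNorm (z - x)) * Real.exp (-(σ / n) * supNorm (x - C')))
    hA hB (fun x z => by have := nrm_pos (x - z); positivity) (fun z x => by have := nrm_pos (z - x); positivity) fun S U => ?_)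
    (le_of_eq (by rw [hc13, hc14, hc23, hc24, hc', hE, hε]))
  -- pointwise: four terms at the common rate
  have hpt : ∀ x z, (K₁ / nrm (x - z) ^ p₁ + K₂ / nrm (x - z) ^ p₂) * Real.exp (-(δ / n) * supNorm (x - z)) * Real.exp (-(σ / n) * supNorm (z - C))
        * ((K₃ / nrm (z - x) ^ p₃ + K₄ / nrm (z - x) ^ p₄) * Real.exp (-(δ / n) * supNorm (z - x)) * Real.exp (-(σ / n) * supNorm (x - C')))
      ≤ K₁ * K₃ * T (p₁ + p₃) x z + K₁ * K₄ * T (p₁ + p₄) x z + K₂ * K₃ * T (p₂ + p₃) x z + K₂ * K₄ * T (p₂ + p₄) x z := by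
    intro x z
    refine (twoTerm_mul_le δ σ hn hK₁ hK₂ hK₃ hK₄ p₁ p₂ p₃ p₄ x z C C').trans (le_of_eq ?_)
    simp only [T, hε]
    ring
  calc ∑ x ∈ S, ∑ z ∈ U, (K₁ / nrm (x - z) ^ p₁ + K₂ / nrm (x - z) ^ p₂) * Real.exp (-(δ / n) * supNorm (x - z)) * Real.exp (-(σ / n) * supNorm (z - C))
        * ((K₃ / nrm (z - x) ^ p₃ + K₄ / nrm (z - x) ^ p₄) * Real.exp (-(δ / n) * supNorm (z - x)) * Real.exp (-(σ / n) * supNorm (x - C')))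
      ≤ ∑ x ∈ S, ∑ z ∈ U, (K₁ * K₃ * T (p₁ + p₃) x z + K₁ * K₄ * T (p₁ + p₄) x z + K₂ * K₃ * T (p₂ + p₃) x z + K₂ * K₄ * T (p₂ + p₄) x z) :=
        Finset.sum_le_sum fun x _ => Finset.sum_le_sum fun z _ => hpt x z
    _ = K₁ * K₃ * ∑ x ∈ S, ∑ z ∈ U, T (p₁ + p₃) x z + K₁ * K₄ * ∑ x ∈ S, ∑ z ∈ U, T (p₁ + p₄) x z
        + K₂ * K₃ * ∑ x ∈ S, ∑ z ∈ U, T (p₂ + p₃) x z + K₂ * K₄ * ∑ x ∈ S, ∑ z ∈ U, T (p₂ + p₄) x z := by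
        simp only [Finset.sum_add_distrib, Finset.mul_sum]
    _ ≤ K₁ * K₃ * (c13 * c' * (n : ℝ) ^ (2 * D - (p₁ + p₃)) * E) + K₁ * K₄ * (c14 * c' * (n : ℝ) ^ (2 * D - (p₁ + p₄)) * E)
        + K₂ * K₃ * (c23 * c' * (n : ℝ) ^ (2 * D - (p₂ + p₃)) * E) + K₂ * K₄ * (c24 * c' * (n : ℝ) ^ (2 * D - (p₂ + p₄)) * E) := by
        gcongr
        · exact hT h13 S U
        · exact hT h14 S U
        · exact hT h23 S U
        · exact hT h24 S U
    _ = _ := by ring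

/-! ## §3 The (5.10) family form: an n-FREE coarse rate -/

/-- [folklore] **THE ORIENTED WORD LETTER, FAMILY FORM (d1-a′)**: vertex families whose right-end compositions carry two-term majorants centred at `n•y`,
`|comp L₁ (𝒱 μ y) x z| ≤ (K₁∕nrm^{p₁} + K₂∕nrm^{p₂})(x−z)·e^{−(δ∕n)‖x−z‖∞}·e^{−(σ∕n)‖z−n•y‖∞}` and `|comp L₂ (𝒱′ ν y) z x| ≤ (K₃∕nrm^{p₃} + K₄∕nrm^{p₄})(z−x)·…·e^{−(σ∕n)‖x−n•y‖∞}`,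
all four `pᵢ + pⱼ ≤ D − 1` ⟹ `Decay510 (z ↦ biBubble L₁ (𝒱 μ 0) L₂ (𝒱′ ν z)) (|F|²·(Σ KᵢKⱼ·c(pᵢ+pⱼ)·n^{2D−(pᵢ+pⱼ)})·c′) (min σ (2δ)∕(2D))`. -/
theorem decay510_biBubble_of_twoTerm (hD : 0 < D) {n : ℕ} (hn : 1 ≤ n) {L₁ L₂ : MKer D F} {𝒱 𝒱' : Fin D → Site D → MKer D F} (μ ν : Fin D)
    {K₁ K₂ K₃ K₄ δ σ : ℝ} {p₁ p₂ p₃ p₄ : ℕ}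
    (hK₁ : 0 ≤ K₁) (hK₂ : 0 ≤ K₂) (hK₃ : 0 ≤ K₃) (hK₄ : 0 ≤ K₄) (hδ : 0 < δ) (hσ : 0 < σ)
    (h13 : p₁ + p₃ ≤ D - 1) (h14 : p₁ + p₄ ≤ D - 1) (h23 : p₂ + p₃ ≤ D - 1) (h24 : p₂ + p₄ ≤ D - 1)
    (hA : ∀ y x z g f, |comp L₁ (𝒱 μ y) x z g f| ≤ (K₁ / nrm (x - z) ^ p₁ + K₂ / nrm (x - z) ^ p₂)
        * Real.exp (-(δ / n) * supNorm (x - z)) * Real.exp (-(σ / n) * supNorm (z - (n : ℤ) • y)))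
    (hB : ∀ y z x f g, |comp L₂ (𝒱' ν y) z x f g| ≤ (K₃ / nrm (z - x) ^ p₃ + K₄ / nrm (z - x) ^ p₄)
        * Real.exp (-(δ / n) * supNorm (z - x)) * Real.exp (-(σ / n) * supNorm (x - (n : ℤ) • y))) :
    Decay510 (fun z => biBubble L₁ (𝒱 μ 0) L₂ (𝒱' ν z))
      ((Fintype.card F : ℝ) ^ 2 *
        ((K₁ * K₃ * (2 * (1 + 2 * D * 3 ^ (D - 1) * ((D - 1 - (p₁ + p₃)).factorial * (8 / min σ (2 * δ)) ^ (D - 1 - (p₁ + p₃)) * (1 + 8 / min σ (2 * δ)))))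
              * (n : ℝ) ^ (2 * D - (p₁ + p₃))
          + K₁ * K₄ * (2 * (1 + 2 * D * 3 ^ (D - 1) * ((D - 1 - (p₁ + p₄)).factorial * (8 / min σ (2 * δ)) ^ (D - 1 - (p₁ + p₄)) * (1 + 8 / min σ (2 * δ)))))
              * (n : ℝ) ^ (2 * D - (p₁ + p₄))
          + K₂ * K₃ * (2 * (1 + 2 * D * 3 ^ (D - 1) * ((D - 1 - (p₂ + p₃)).factorial * (8 / min σ (2 * δ)) ^ (D - 1 - (p₂ + p₃)) * (1 + 8 / min σ (2 * δ)))))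
              * (n : ℝ) ^ (2 * D - (p₂ + p₃))
          + K₂ * K₄ * (2 * (1 + 2 * D * 3 ^ (D - 1) * ((D - 1 - (p₂ + p₄)).factorial * (8 / min σ (2 * δ)) ^ (D - 1 - (p₂ + p₄)) * (1 + 8 / min σ (2 * δ)))))
              * (n : ℝ) ^ (2 * D - (p₂ + p₄)))
          * (1 + 2 * D * 3 ^ (D - 1) * ((D - 1).factorial * (4 / min σ (2 * δ)) ^ (D - 1) * (1 + 4 / min σ (2 * δ))))))
      (min σ (2 * δ) / 2 / D) := by
  intro z
  have h := abs_tr_comp_le_of_twoTerm hD hn hK₁ hK₂ hK₃ hK₄ hδ hσ h13 h14 h23 h24 (hA 0) (hB z)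
  unfold PackedKernelSplit.biBubble
  refine h.trans ?_
  have hε0 : 0 ≤ min σ (2 * δ) / 2 := by have := lt_min hσ (by linarith : (0:ℝ) < 2 * δ); linarith
  have hc := exp_centres_le hD hn hε0 z
  have hpos : 0 < min σ (2 * δ) := lt_min hσ (by linarith)
  have hK : 0 ≤ (Fintype.card F : ℝ) ^ 2 *
        ((K₁ * K₃ * (2 * (1 + 2 * D * 3 ^ (D - 1) * ((D - 1 - (p₁ + p₃)).factorial * (8 / min σ (2 * δ)) ^ (D - 1 - (p₁ + p₃)) * (1 + 8 / min σ (2 * δ)))))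
              * (n : ℝ) ^ (2 * D - (p₁ + p₃))
          + K₁ * K₄ * (2 * (1 + 2 * D * 3 ^ (D - 1) * ((D - 1 - (p₁ + p₄)).factorial * (8 / min σ (2 * δ)) ^ (D - 1 - (p₁ + p₄)) * (1 + 8 / min σ (2 * δ)))))
              * (n : ℝ) ^ (2 * D - (p₁ + p₄))
          + K₂ * K₃ * (2 * (1 + 2 * D * 3 ^ (D - 1) * ((D - 1 - (p₂ + p₃)).factorial * (8 / min σ (2 * δ)) ^ (D - 1 - (p₂ + p₃)) * (1 + 8 / min σ (2 * δ)))))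
              * (n : ℝ) ^ (2 * D - (p₂ + p₃))
          + K₂ * K₄ * (2 * (1 + 2 * D * 3 ^ (D - 1) * ((D - 1 - (p₂ + p₄)).factorial * (8 / min σ (2 * δ)) ^ (D - 1 - (p₂ + p₄)) * (1 + 8 / min σ (2 * δ)))))
              * (n : ℝ) ^ (2 * D - (p₂ + p₄)))
          * (1 + 2 * D * 3 ^ (D - 1) * ((D - 1).factorial * (4 / min σ (2 * δ)) ^ (D - 1) * (1 + 4 / min σ (2 * δ))))) := by
    positivity
  calc _ = ((Fintype.card F : ℝ) ^ 2 *
        ((K₁ * K₃ * (2 * (1 + 2 * D * 3 ^ (D - 1) * ((D - 1 - (p₁ + p₃)).factorial * (8 / min σ (2 * δ)) ^ (D - 1 - (p₁ + p₃)) * (1 + 8 / min σ (2 * δ)))))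
              * (n : ℝ) ^ (2 * D - (p₁ + p₃))
          + K₁ * K₄ * (2 * (1 + 2 * D * 3 ^ (D - 1) * ((D - 1 - (p₁ + p₄)).factorial * (8 / min σ (2 * δ)) ^ (D - 1 - (p₁ + p₄)) * (1 + 8 / min σ (2 * δ)))))
              * (n : ℝ) ^ (2 * D - (p₁ + p₄))
          + K₂ * K₃ * (2 * (1 + 2 * D * 3 ^ (D - 1) * ((D - 1 - (p₂ + p₃)).factorial * (8 / min σ (2 * δ)) ^ (D - 1 - (p₂ + p₃)) * (1 + 8 / min σ (2 * δ)))))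
              * (n : ℝ) ^ (2 * D - (p₂ + p₃))
          + K₂ * K₄ * (2 * (1 + 2 * D * 3 ^ (D - 1) * ((D - 1 - (p₂ + p₄)).factorial * (8 / min σ (2 * δ)) ^ (D - 1 - (p₂ + p₄)) * (1 + 8 / min σ (2 * δ)))))
              * (n : ℝ) ^ (2 * D - (p₂ + p₄)))
          * (1 + 2 * D * 3 ^ (D - 1) * ((D - 1).factorial * (4 / min σ (2 * δ)) ^ (D - 1) * (1 + 4 / min σ (2 * δ))))))
        * Real.exp (-(min σ (2 * δ) / 2 / n) * supNorm ((n : ℤ) • (0 : Site D) - (n : ℤ) • z)) := by ring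
    _ ≤ _ := mul_le_mul_of_nonneg_left hc hK

/-! ## §4 The tadpole over a finite-range two-centre table: `sup × (2r+1)^D × centre count` -/

/-- [folklore] **TADPOLE WITH A FINITE-RANGE TWO-CENTRE TABLE**: `|L x y| ≤ S`, `|W y x| ≤ A₂·e^{−(σ∕n)‖x−C‖∞}·e^{−(σ∕n)‖x−C′‖∞}`, `W y x = 0` unless
`‖y−x‖∞ ≤ r` (`S, A₂ ≥ 0`, `σ > 0`, `n ≥ 1`) ⟹ `|tadpole L W| ≤ |F|²·(S·(2r+1)^D·A₂·(1 + 2D·3^{D−1}·((D−1)!·(4∕σ)^{D−1}·(1+4∕σ)))·n^D)·e^{−(σ∕2n)‖C−C′‖∞}`. -/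
theorem abs_tadpole_le_of_sup_range (hD : 0 < D) {n : ℕ} (hn : 1 ≤ n) {L W : MKer D F} {S A₂ σ : ℝ} {r : ℕ} {C C' : Site D}
    (hS : 0 ≤ S) (hA₂ : 0 ≤ A₂) (hσ : 0 < σ)
    (hL : ∀ x y g f, |L x y g f| ≤ S)
    (hW : ∀ y x f g, |W y x f g| ≤ A₂ * Real.exp (-(σ / n) * supNorm (x - C)) * Real.exp (-(σ / n) * supNorm (x - C')))
    (hWr : ∀ y x f g, r < supNorm (y - x) → W y x f g = 0) :
    |tadpole L W| ≤ (Fintype.card F : ℝ) ^ 2 *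
      (S * (2 * r + 1) ^ D * A₂ * (1 + 2 * D * 3 ^ (D - 1) * ((D - 1).factorial * (4 / σ) ^ (D - 1) * (1 + 4 / σ))) * (n : ℝ) ^ D
        * Real.exp (-(σ / 2 / n) * supNorm (C - C'))) := by
  classical
  have hn0 : (0 : ℝ) < n := by exact_mod_cast hn
  have hσn : 0 ≤ σ / n := by positivity
  -- the range-restricted table majorant
  let M₂ : Site D → Site D → ℝ := fun y x =>
    if supNorm (y - x) ≤ r then A₂ * Real.exp (-(σ / n) * supNorm (x - C)) * Real.exp (-(σ / n) * supNorm (x - C')) else 0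
  have hM₂ : ∀ y x f g, |W y x f g| ≤ M₂ y x := by
    intro y x f g
    by_cases h : supNorm (y - x) ≤ r
    · simp only [M₂, if_pos h]; exact hW y x f g
    · simp only [M₂, if_neg h]; rw [hWr y x f g (lt_of_not_ge h), abs_zero]
  have hM₂0 : ∀ y x, 0 ≤ M₂ y x := fun y x => by
    simp only [M₂]; split_ifs <;> positivity
  unfold ExpKernelCalculus.tadpole
  refine abs_tr_comp_le_of_majorant (M₁ := fun _ _ => S) (M₂ := M₂) (fun x y g f => hL x y g f) hM₂ (fun _ _ => hS) hM₂0 fun T U => ?_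
  -- the double sum: `y ∈ cube x r`, then the two-centre count in `x`
  have hinner : ∀ x, ∑ y ∈ U, S * M₂ y x
      ≤ S * ((2 * r + 1) ^ D * (A₂ * Real.exp (-(σ / n) * supNorm (x - C)) * Real.exp (-(σ / n) * supNorm (x - C')))) := by
    intro x
    rw [← Finset.mul_sum]
    refine mul_le_mul_of_nonneg_left ?_ hS
    have hsub : ∑ y ∈ U, M₂ y x ≤ ∑ y ∈ cube x r, A₂ * Real.exp (-(σ / n) * supNorm (x - C)) * Real.exp (-(σ / n) * supNorm (x - C')) := by
      calc ∑ y ∈ U, M₂ y x = ∑ y ∈ U.filter (fun y => supNorm (y - x) ≤ r),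
            A₂ * Real.exp (-(σ / n) * supNorm (x - C)) * Real.exp (-(σ / n) * supNorm (x - C')) := by
            rw [Finset.sum_filter]
        _ ≤ ∑ y ∈ cube x r, A₂ * Real.exp (-(σ / n) * supNorm (x - C)) * Real.exp (-(σ / n) * supNorm (x - C')) := by
            refine Finset.sum_le_sum_of_subset_of_nonneg (fun y hy => ?_) (fun _ _ _ => by positivity)
            rw [Finset.mem_filter] at hy
            exact mem_cube_iff_supNorm.2 hy.2
    refine hsub.trans (le_of_eq ?_)
    rw [Finset.sum_const, card_cube, nsmul_eq_mul]
    push_cast; ring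
  have hn1 : (1 : ℝ) ≤ n := by exact_mod_cast hn
  have hcount : ∑ x ∈ T, ((supNorm (x - C) : ℕ) : ℝ) ^ 0 * Real.exp (-(σ / 2 / n) * supNorm (x - C))
      ≤ (1 + 2 * D * 3 ^ (D - 1) * ((D - 1).factorial * (4 / σ) ^ (D - 1) * (1 + 4 / σ))) * (n : ℝ) ^ D := by
    have h := sum_pow_mul_exp_scale_le hD (half_pos hσ) hn 0 T C
    have e4 : (2 : ℝ) / (σ / 2) = 4 / σ := by field_simp; ring
    rw [zero_add, e4] at h
    refine h.trans ?_
    have hnD : (1 : ℝ) ≤ (n : ℝ) ^ D := one_le_pow₀ hn1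
    have hc0 : (0 : ℝ) ≤ 2 * D * 3 ^ (D - 1) * ((D - 1).factorial * (4 / σ) ^ (D - 1) * (1 + 4 / σ)) := by positivity
    nlinarith [mul_nonneg hc0 (le_trans zero_le_one hnD)]
  have hhalf : ∀ x, Real.exp (-(σ / n) * supNorm (x - C)) * Real.exp (-(σ / n) * supNorm (x - C'))
      ≤ Real.exp (-(σ / 2 / n) * supNorm (C - C')) * Real.exp (-(σ / 2 / n) * supNorm (x - C)) := by
    intro x
    have htri : supNorm (C - C') ≤ supNorm (x - C) + supNorm (x - C') := by
      have h1 := supNorm_add_le (C - x) (x - C')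
      rw [show C - x + (x - C') = C - C' by abel, show C - x = -(x - C) by abel, supNorm_neg] at h1
      exact h1
    have htri' : (supNorm (C - C') : ℝ) ≤ supNorm (x - C) + supNorm (x - C') := by exact_mod_cast htri
    have t1 : (0 : ℝ) ≤ supNorm (x - C') := Nat.cast_nonneg _
    rw [← Real.exp_add, ← Real.exp_add]
    apply Real.exp_le_exp.mpr
    have e1 : σ / 2 / (n : ℝ) = (σ / n) / 2 := by ring
    rw [e1]
    nlinarith [mul_nonneg hσn t1]
  calc ∑ x ∈ T, ∑ y ∈ U, S * M₂ y x
      ≤ ∑ x ∈ T, S * ((2 * r + 1) ^ D * (A₂ * Real.exp (-(σ / n) * supNorm (x - C)) * Real.exp (-(σ / n) * supNorm (x - C')))) :=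
        Finset.sum_le_sum fun x _ => hinner x
    _ ≤ ∑ x ∈ T, S * ((2 * r + 1) ^ D * (A₂ * (Real.exp (-(σ / 2 / n) * supNorm (C - C')) * Real.exp (-(σ / 2 / n) * supNorm (x - C))))) := by
        refine Finset.sum_le_sum fun x _ => ?_
        have := hhalf x
        have h0 : 0 ≤ S * ((2 * (r : ℝ) + 1) ^ D * A₂) := by positivity
        calc S * ((2 * (r:ℝ) + 1) ^ D * (A₂ * Real.exp (-(σ / n) * supNorm (x - C)) * Real.exp (-(σ / n) * supNorm (x - C'))))
            = S * ((2 * (r:ℝ) + 1) ^ D * A₂) * (Real.exp (-(σ / n) * supNorm (x - C)) * Real.exp (-(σ / n) * supNorm (x - C'))) := by ring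
          _ ≤ S * ((2 * (r:ℝ) + 1) ^ D * A₂) * (Real.exp (-(σ / 2 / n) * supNorm (C - C')) * Real.exp (-(σ / 2 / n) * supNorm (x - C))) :=
              mul_le_mul_of_nonneg_left this h0
          _ = _ := by ring
    _ = S * (2 * r + 1) ^ D * A₂ * Real.exp (-(σ / 2 / n) * supNorm (C - C'))
        * ∑ x ∈ T, ((supNorm (x - C) : ℕ) : ℝ) ^ 0 * Real.exp (-(σ / 2 / n) * supNorm (x - C)) := by
        rw [Finset.mul_sum]; refine Finset.sum_congr rfl fun x _ => ?_; rw [pow_zero]; ring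
    _ ≤ S * (2 * r + 1) ^ D * A₂ * Real.exp (-(σ / 2 / n) * supNorm (C - C'))
        * ((1 + 2 * D * 3 ^ (D - 1) * ((D - 1).factorial * (4 / σ) ^ (D - 1) * (1 + 4 / σ))) * (n : ℝ) ^ D) :=
        mul_le_mul_of_nonneg_left hcount (by positivity)
    _ = _ := by ring

/-- [folklore] **… FAMILY FORM**: a table family `𝒲 μ y ν y′` of range `r` with two-centre density `A₂·e^{−(σ∕n)‖x−n•y‖∞}·e^{−(σ∕n)‖x−n•y′‖∞}` against a
leg with `|L| ≤ S` ⟹ `Decay510 (z ↦ tadpole L (𝒲 μ 0 ν z)) (|F|²·S·(2r+1)^D·A₂·K″·n^D) (σ∕(2D))`. -/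
theorem decay510_tadpole_of_sup_range (hD : 0 < D) {n : ℕ} (hn : 1 ≤ n) {L : MKer D F} {𝒲 : Fin D → Site D → Fin D → Site D → MKer D F}
    (μ ν : Fin D) {S A₂ σ : ℝ} {r : ℕ} (hS : 0 ≤ S) (hA₂ : 0 ≤ A₂) (hσ : 0 < σ)
    (hL : ∀ x y g f, |L x y g f| ≤ S)
    (hW : ∀ y' y x f g, |𝒲 μ 0 ν y' y x f g| ≤ A₂ * Real.exp (-(σ / n) * supNorm (x - (n : ℤ) • (0 : Site D))) * Real.exp (-(σ / n) * supNorm (x - (n : ℤ) • y')))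
    (hWr : ∀ y' y x f g, r < supNorm (y - x) → 𝒲 μ 0 ν y' y x f g = 0) :
    Decay510 (fun z => tadpole L (𝒲 μ 0 ν z))
      ((Fintype.card F : ℝ) ^ 2 * (S * (2 * r + 1) ^ D * A₂ * (1 + 2 * D * 3 ^ (D - 1) * ((D - 1).factorial * (4 / σ) ^ (D - 1) * (1 + 4 / σ))) * (n : ℝ) ^ D))
      (σ / 2 / D) := by
  intro z
  have h := abs_tadpole_le_of_sup_range hD hn hS hA₂ hσ hL (hW z) (hWr z)
  refine h.trans ?_
  have hc := exp_centres_le hD hn (half_pos hσ).le z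
  have hK : 0 ≤ (Fintype.card F : ℝ) ^ 2 * (S * (2 * r + 1) ^ D * A₂ * (1 + 2 * D * 3 ^ (D - 1) * ((D - 1).factorial * (4 / σ) ^ (D - 1) * (1 + 4 / σ))) * (n : ℝ) ^ D) := by
    positivity
  calc _ = (Fintype.card F : ℝ) ^ 2 * (S * (2 * r + 1) ^ D * A₂ * (1 + 2 * D * 3 ^ (D - 1) * ((D - 1).factorial * (4 / σ) ^ (D - 1) * (1 + 4 / σ))) * (n : ℝ) ^ D)
        * Real.exp (-(σ / 2 / n) * supNorm ((n : ℤ) • (0 : Site D) - (n : ℤ) • z)) := by ring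
    _ ≤ _ := mul_le_mul_of_nonneg_left hc hK

/-! ## §5 Power bookkeeping for the rows file -/

omit [Fintype F] in
/-- [folklore] **n-POWER BOOKKEEPING**: `0 ≤ K ≤ c∕n^e`, `0 ≤ K′ ≤ c′∕n^{e′}`, `0 ≤ M`, `q + t ≤ e + e′`, `1 ≤ n` ⟹ `K·K′·M·n^q ≤ c·c′·M·(n^t)⁻¹`
(each of the four terms of §2 at `q = 2D − (pᵢ+pⱼ)`; at `D = 4`, `t = 8` this is the rows' currency). -/
theorem pow_bookkeeping {n : ℕ} (hn : 1 ≤ n) {K K' c c' M : ℝ} {e e' q t : ℕ} (hK0 : 0 ≤ K) (hK'0 : 0 ≤ K') (hM : 0 ≤ M)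
    (hK : K ≤ c / (n : ℝ) ^ e) (hK' : K' ≤ c' / (n : ℝ) ^ e') (hqt : q + t ≤ e + e') :
    K * K' * M * (n : ℝ) ^ q ≤ c * c' * M * ((n : ℝ) ^ t)⁻¹ := by
  have hn1 : (1 : ℝ) ≤ n := by exact_mod_cast hn
  have hn0 : (0 : ℝ) < n := by linarith
  have hc : 0 ≤ c := by
    have := hK0.trans hK; rw [le_div_iff₀ (pow_pos hn0 _)] at this; nlinarith [pow_pos hn0 e]
  have hc' : 0 ≤ c' := by
    have := hK'0.trans hK'; rw [le_div_iff₀ (pow_pos hn0 _)] at this; nlinarith [pow_pos hn0 e']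
  have h1 : K * K' ≤ c / (n : ℝ) ^ e * (c' / (n : ℝ) ^ e') := mul_le_mul hK hK' hK'0 (hK0.trans hK)
  have key : (n : ℝ) ^ q / (n : ℝ) ^ (e + e') ≤ ((n : ℝ) ^ t)⁻¹ := by
    rw [inv_eq_one_div, div_le_div_iff₀ (pow_pos hn0 _) (pow_pos hn0 _), one_mul, ← pow_add]
    exact pow_le_pow_right₀ hn1 hqt
  have h2 : c / (n : ℝ) ^ e * (c' / (n : ℝ) ^ e') * (n : ℝ) ^ q ≤ c * c' * ((n : ℝ) ^ t)⁻¹ := by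
    have e1 : c / (n : ℝ) ^ e * (c' / (n : ℝ) ^ e') * (n : ℝ) ^ q = c * c' * ((n : ℝ) ^ q / (n : ℝ) ^ (e + e')) := by
      rw [pow_add]; field_simp
    rw [e1]
    exact mul_le_mul_of_nonneg_left key (mul_nonneg hc hc')
  calc K * K' * M * (n : ℝ) ^ q = (K * K') * (n : ℝ) ^ q * M := by ring
    _ ≤ (c / (n : ℝ) ^ e * (c' / (n : ℝ) ^ e')) * (n : ℝ) ^ q * M :=
        mul_le_mul_of_nonneg_right (mul_le_mul_of_nonneg_right h1 (pow_nonneg hn0.le _)) hM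
    _ ≤ c * c' * ((n : ℝ) ^ t)⁻¹ * M := mul_le_mul_of_nonneg_right h2 hM
    _ = _ := by ring

end Summit.QuantumFields.BalabanUV.Beta.D1BFx.OrientedProfileWords

end
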